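import Summits.QuantumFields.YangMills.Theses.LangevinControlUV

/-!
# Sketch — crux `LatticeGapInUVUnitsC` (stmt-QuantumFields-16206), idea `amplitude-exhaustion-ratchet`

crux-ideate round 1, ideator 1 (planner-cruxidea-stmt-QuantumFields-16206-1-0), 2026-08-16.

The lever: the dimensionless TOP-OF-BOX curvature amplitude `u(β, L) := (L/8)⁸ · Cov_{β,L}(P_0^{01}, P_{(L/8)e₂}^{01})`
(the package's own observable, read on the torus of side `L` itself) is

* SEEDED from below at the femto edge `L₀(β) = ℓ₀/a(β)` by the package's LOWER bound (interval pinning for continuous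
  rulers, landed `twoPointPinned_of_continuous`) — this is where dimensional transmutation is consumed;
* BOUNDED above at all larger scales (`U_max`, stub R2);
* and subject to a per-window DICHOTOMY (stub R4, the bet): over `M` octaves it either grows by a factor `1 + δ` or a
  mixing certificate `Cert β L` fires at the new scale.

Then the certificate fires within `J = O(log(U_max/u_min)/log(1+δ))` windows, i.e. at lattice scale
`≤ 2^{MJ} L₀(β)`, with `J` INDEPENDENT of `β` — the confinement scale `K = 2^{MJ}` is OUTPUT, not input — and any landed
certificate pipeline (`reduction_concl_of_localPoincare`, `cruxRepaired_of_femtoSlab`) whose rate is `c_*/cell` returns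
the crux's conclusion with `c₁ = c_*/(2^{MJ} ℓ₀)`.

§1 `exhaustion` — the pure bookkeeping (PROVED).
§2 `topAmp` — the ratchet quantity over the route's vocabulary.
§3 `CertClusters` — the shape the certify-branch must deliver (= output shape of the landed `stub_gapToClustering`).
§4 `concl_of_ratchet` — seed ∧ bound ∧ dichotomy ∧ certificate-pipeline ⇒ `Concl` (PROVED).
-/

namespace Summit.QuantumFields.YangMills.Cruxes.LatticeGapInUVUnitsC.AmplitudeRatchet

open MeasureTheory Filter Topology
open Literature.MathematicalPhysics.QuantumFieldTheory Literature.MathematicalPhysics.QuantumLattice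

noncomputable section

/-! ## §1 Exhaustion of a bounded quantity under a grow-or-certify dichotomy -/

/-- **Exhaustion lemma.** A real sequence seeded at `u 0 ≥ umin > 0`, bounded by `U`, which at every step either grows
by the factor `1 + δ` or triggers `P` at the next index, triggers `P` at some index `1 ≤ j ≤ J` as soon as
`(1+δ)^J · umin > U`. [folklore] -/
theorem exhaustion {u : ℕ → ℝ} {P : ℕ → Prop} {umin U δ : ℝ} {J : ℕ} (hδ : 0 ≤ δ)
    (h0 : umin ≤ u 0) (hbound : ∀ j, j ≤ J → u j ≤ U)
    (hdich : ∀ j, j < J → (1 + δ) * u j ≤ u (j + 1) ∨ P (j + 1))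
    (hJ : U < (1 + δ) ^ J * umin) :
    ∃ j, 1 ≤ j ∧ j ≤ J ∧ P j := by
  by_contra hno
  push Not at hno
  -- without any trigger, the sequence grows geometrically up to index `J`
  have hgrow : ∀ j, j ≤ J → (1 + δ) ^ j * umin ≤ u j := by
    intro j
    induction j with
    | zero => intro _; simpa using h0
    | succ k ih =>
      intro hk
      have hk' : k < J := Nat.lt_of_succ_le hk
      have hk'' : k ≤ J := hk'.le
      rcases hdich k hk' with hle | hP
      · calc (1 + δ) ^ (k + 1) * umin = (1 + δ) * ((1 + δ) ^ k * umin) := by ring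
          _ ≤ (1 + δ) * u k := mul_le_mul_of_nonneg_left (ih hk'') (by linarith)
          _ ≤ u (k + 1) := hle
      · exact absurd hP (hno (k + 1) (Nat.succ_le_succ (Nat.zero_le k)) hk)
  have h1 := hgrow J le_rfl
  have h2 := hbound J le_rfl
  linarith

/-- A window count `J` with `(1+δ)^J · umin > U` exists for every `δ > 0`. [folklore] -/
theorem exists_window_count {umin U δ : ℝ} (hmin : 0 < umin) (hδ : 0 < δ) :
    ∃ J : ℕ, U < (1 + δ) ^ J * umin := by
  obtain ⟨J, hJ⟩ := pow_unbounded_of_one_lt (U / umin) (by linarith : (1 : ℝ) < 1 + δ)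
  exact ⟨J, by rwa [div_lt_iff₀ hmin] at hJ⟩

/-! ## §2 The ratchet quantity: the top-of-box curvature amplitude on the torus of side `L` -/

variable {G : Type} [Group G] [TopologicalSpace G] [IsTopologicalGroup G] [CompactSpace G]
  [MeasurableSpace G] [BorelSpace G]

/-- `u(β, L) = (L/8)⁸ · Cov_{β,L}(P_0^{01}, P_{(L/8) e₂}^{01})` on the periodic torus `(ℤ/L)⁴` (and `0` for the empty
torus `L = 0`): the package's axis observable at the largest separation the package pins, `n = L/8`, read on the torus of
side `L` itself — femto for `L ≤ ℓ₀/a(β)`, beyond the package for larger `L`. Dimensionless; physically `≍ ḡ⁴(L a/8)`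
while perturbative, `≍ y⁸𝒢(y)`, `y = Λ L a/8`, in general. -/
def topAmp (r : LatticeRep G) (β : ℝ) (L : ℕ) : ℝ :=
  if hL : L = 0 then 0 else
    haveI : NeZero L := ⟨hL⟩
    let n : ℕ := L / 8
    let P : (Fin 4 → ZMod L) → GaugeConfig 4 L G → ℝ :=
      fun x U => (r.N : ℝ) - (r.ρ (plaquetteHolonomy U x 0 1)).trace.re
    let E : (GaugeConfig 4 L G → ℝ) → ℝ := fun F => wilsonExpectation (d := 4) (L := L) r.ρ β F
    (n : ℝ) ^ 8 *
      (E (fun U => P 0 U * P (Pi.single (2 : Fin 4) ((n : ℕ) : ZMod L)) U) -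
        E (P 0) * E (P (Pi.single (2 : Fin 4) ((n : ℕ) : ZMod L))))

/-! ## §3 What the certify-branch must deliver -/

/-- Clustering at rate `c/b` per lattice step from a certificate `Cert β b` at cell `b`, on all tori of side
`2S+1` with `S ≥ K·b`, with pair-dependent `β`-uniform constants: EXACTLY the output shape of the landed Knabe pipeline
(`stub_gapToClustering`: `GlobalPoincare` at cell `b` ⇒ `|corr| ≤ C e^{-ρ n/b}`) and of the slab pipeline
(`stub_decayToClustering`: rate `κ(q)/D`). -/
def CertClusters (r : LatticeRep G) (Cert : ℝ → ℕ → Prop) (c K β₂ : ℝ) : Prop :=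
  ∀ A B : YMSpecies G, ∃ C : ℝ, ∀ β : ℝ, β₂ ≤ β → ∀ b : ℕ, 1 ≤ b → Cert β b →
    ∀ S n : ℕ, K * b ≤ S → n ≤ S →
      |latticeConnectedCorr r.ρ β (2 * S + 1) A.F B.F n| ≤ C * Real.exp (-(c * n / b))

/-! ## §4 The ratchet reduction: seed ∧ bound ∧ dichotomy ∧ certificate pipeline ⇒ `Concl` -/

/-- **`Concl` from the amplitude ratchet** (stated for ANY dimensionless scale function `amp β L`; the line uses
`amp = topAmp r`, the self-normalised variant `C_L(L/8)/C_L(L/16)` is the `U = 1` fallback). Hypotheses, for `β ≥ β₂`: the femto-edge scale `L₀(β) ≥ 1` with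
`L₀(β)·a(β) ≤ ℓ₀` (the package's top femto box); SEED `u(β, L₀ β) ≥ umin` (stub R1 — from the package by interval
pinning); BOUND `u(β, 2^{Mj} L₀ β) ≤ U` for all `j ≤ J` (stub R2); DICHOTOMY over windows of `M` octaves (stub R4);
the certificate pipeline `CertClusters` (landed for the two certificates on the ledger); and the window count
`(1+δ)^J umin > U` (`exists_window_count`). Conclusion: the crux's `Concl` with `c₁ = c/(2^{MJ} ℓ₀)`,
`S₁ β = ⌈K⌉ · 2^{MJ} L₀ β`. The confinement scale `2^{MJ}` is an OUTPUT of the bookkeeping. -/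
theorem concl_of_ratchet (r : LatticeRep G) {a : ℝ → ℝ} (hpos : ∀ β, 0 < a β)
    (amp : ℝ → ℕ → ℝ)
    {ℓ₀ β₂ umin U δ c K : ℝ} (_humin : 0 < umin) (hδ : 0 ≤ δ) (hc : 0 < c) (hℓ₀ : 0 < ℓ₀)
    (L₀ : ℝ → ℕ) (hL₀pos : ∀ β, β₂ ≤ β → 1 ≤ L₀ β) (hL₀ : ∀ β, β₂ ≤ β → (L₀ β : ℝ) * a β ≤ ℓ₀)
    (M J : ℕ) (hJ : U < (1 + δ) ^ J * umin) (Cert : ℝ → ℕ → Prop)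
    (hseed : ∀ β, β₂ ≤ β → umin ≤ amp β (L₀ β))
    (hbound : ∀ β, β₂ ≤ β → ∀ j : ℕ, j ≤ J → amp β (2 ^ (M * j) * L₀ β) ≤ U)
    (hdich : ∀ β, β₂ ≤ β → ∀ j : ℕ, j < J →
      (1 + δ) * amp β (2 ^ (M * j) * L₀ β) ≤ amp β (2 ^ (M * (j + 1)) * L₀ β) ∨
        Cert β (2 ^ (M * (j + 1)) * L₀ β))
    (hcert : CertClusters r Cert c K β₂) :
    ∃ (c₁ β₂' : ℝ) (S₁ : ℝ → ℕ), 0 < c₁ ∧ ∀ A B : YMSpecies G, ∃ C : ℝ, ∀ β : ℝ, β₂' ≤ β → ∀ S n : ℕ,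
      S₁ β ≤ S → n ≤ S →
        |latticeConnectedCorr r.ρ β (2 * S + 1) A.F B.F n| ≤ C * Real.exp (-(c₁ * a β * n)) := by
  -- the maximal cell the ratchet can reach: `2^{MJ} · L₀ β`
  set T : ℕ := 2 ^ (M * J) with hT
  have hTpos : (0 : ℝ) < T := by positivity
  refine ⟨c / (T * ℓ₀), β₂, fun β => ⌈K⌉₊ * (T * L₀ β), by positivity, fun A B => ?_⟩
  obtain ⟨C, hC⟩ := hcert A B
  refine ⟨max C 0, fun β hβ S n hS hn => ?_⟩
  -- run the exhaustion at this `β`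
  obtain ⟨j, hj1, hjJ, hPj⟩ := exhaustion (u := fun j => amp β (2 ^ (M * j) * L₀ β))
    (P := fun j => Cert β (2 ^ (M * j) * L₀ β)) hδ (by simpa using hseed β hβ) (hbound β hβ)
    (hdich β hβ) hJ
  -- the certified cell `b = 2^{Mj} L₀ β`, with `1 ≤ b ≤ T · L₀ β`
  set b : ℕ := 2 ^ (M * j) * L₀ β with hb
  have hL₀1 : 1 ≤ L₀ β := hL₀pos β hβ
  have hb1 : 1 ≤ b := by
    have : 1 ≤ 2 ^ (M * j) := Nat.one_le_two_pow
    calc 1 = 1 * 1 := by ring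
      _ ≤ 2 ^ (M * j) * L₀ β := Nat.mul_le_mul this hL₀1
  have hbT : b ≤ T * L₀ β := by
    have : 2 ^ (M * j) ≤ 2 ^ (M * J) := Nat.pow_le_pow_right (by norm_num) (Nat.mul_le_mul_left M hjJ)
    exact Nat.mul_le_mul_right (L₀ β) this
  -- torus large enough for the pipeline at cell `b`
  have hKb : K * (b : ℝ) ≤ S := by
    have h1 : K * (b : ℝ) ≤ (⌈K⌉₊ : ℝ) * ((T * L₀ β : ℕ) : ℝ) := by
      refine mul_le_mul (Nat.le_ceil K) (by exact_mod_cast hbT) (by positivity) (by positivity)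
    have h2 : ((⌈K⌉₊ : ℝ) * ((T * L₀ β : ℕ) : ℝ)) = ((⌈K⌉₊ * (T * L₀ β) : ℕ) : ℝ) := by push_cast; ring
    rw [h2] at h1
    exact h1.trans (by exact_mod_cast hS)
  have hcorr := hC β hβ b hb1 hPj S n hKb hn
  refine hcorr.trans ?_
  -- compare the exponents: `c/(T ℓ₀) · a β · n ≤ c · n / b` because `b · a β ≤ T · L₀ β · a β ≤ T · ℓ₀`
  have hbpos : (0 : ℝ) < b := by exact_mod_cast hb1
  have hba : (b : ℝ) * a β ≤ T * ℓ₀ := by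
    have h1 : (b : ℝ) * a β ≤ ((T * L₀ β : ℕ) : ℝ) * a β :=
      mul_le_mul_of_nonneg_right (by exact_mod_cast hbT) (hpos β).le
    have h2 : ((T * L₀ β : ℕ) : ℝ) * a β = (T : ℝ) * ((L₀ β : ℝ) * a β) := by push_cast; ring
    rw [h2] at h1
    exact h1.trans (mul_le_mul_of_nonneg_left (hL₀ β hβ) hTpos.le)
  have hn0 : (0 : ℝ) ≤ n := Nat.cast_nonneg n
  have key : c / (T * ℓ₀) * a β * n ≤ c * n / b := by
    rw [le_div_iff₀ hbpos]
    have e : c / (T * ℓ₀) * a β * n * b = c * n * ((b : ℝ) * a β) / (T * ℓ₀) := by ring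
    rw [e, div_le_iff₀ (by positivity : (0 : ℝ) < T * ℓ₀)]
    exact mul_le_mul_of_nonneg_left hba (by positivity)
  calc C * Real.exp (-(c * n / b)) ≤ max C 0 * Real.exp (-(c * n / b)) :=
        mul_le_mul_of_nonneg_right (le_max_left _ _) (Real.exp_pos _).le
    _ ≤ max C 0 * Real.exp (-(c / (T * ℓ₀) * a β * n)) :=
        mul_le_mul_of_nonneg_left (Real.exp_le_exp.2 (neg_le_neg key)) (le_max_right _ _)

/-! ## §5 The composition concludes the crux BY NAME -/

/-- The ratchet data at `(G, r, a)`: everything `concl_of_ratchet` consumes — femto-edge scale `L₀`, seed (R1), bound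
(R2), windowed dichotomy (R4), certificate pipeline (landed shape), window count. -/
def RatchetData (r : LatticeRep G) (a : ℝ → ℝ) : Prop :=
  ∃ (ℓ₀ β₂ umin U δ c K : ℝ) (L₀ : ℝ → ℕ) (M J : ℕ) (Cert : ℝ → ℕ → Prop),
    0 < umin ∧ 0 ≤ δ ∧ 0 < c ∧ 0 < ℓ₀ ∧ U < (1 + δ) ^ J * umin ∧
    (∀ β, β₂ ≤ β → 1 ≤ L₀ β) ∧ (∀ β, β₂ ≤ β → (L₀ β : ℝ) * a β ≤ ℓ₀) ∧
    (∀ β, β₂ ≤ β → umin ≤ topAmp r β (L₀ β)) ∧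
    (∀ β, β₂ ≤ β → ∀ j : ℕ, j ≤ J → topAmp r β (2 ^ (M * j) * L₀ β) ≤ U) ∧
    (∀ β, β₂ ≤ β → ∀ j : ℕ, j < J →
      (1 + δ) * topAmp r β (2 ^ (M * j) * L₀ β) ≤ topAmp r β (2 ^ (M * (j + 1)) * L₀ β) ∨
        Cert β (2 ^ (M * (j + 1)) * L₀ β)) ∧
    CertClusters r Cert c K β₂

omit [MeasurableSpace G] [BorelSpace G] in
/-- **The ratchet concludes `LatticeGapInUVUnitsC` by name.** If for every compact simple `G`, faithful unitary `r`
and continuous positive unit map `a → 0` the ratchet data are available, the crux holds. (Inside a line, `RatchetData`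
is produced FROM the package: the seed by interval pinning, `L₀ β := ⌊ℓ₀/(8 a β)⌋·8`-type choice; here the package is
only used for `0 < a` and `a → 0`.) -/
theorem latticeGapInUVUnitsC_of_ratchet
    (h : ∀ (G : Type) [Group G] [TopologicalSpace G] [IsTopologicalGroup G] [CompactSpace G],
      IsCompactSimpleLieGroup G → letI : MeasurableSpace G := borel G; haveI : BorelSpace G := ⟨rfl⟩;
      ∀ (r : LatticeRep G) (a : ℝ → ℝ), Continuous a → (∀ β, 0 < a β) → Tendsto a atTop (𝓝 0) →
        RatchetData r a) :
    Summit.QuantumFields.YangMills.Theses.LangevinControlUV.LatticeGapInUVUnitsC := by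
  intro G _ _ _ _ hG
  letI : MeasurableSpace G := borel G
  haveI : BorelSpace G := ⟨rfl⟩
  intro r a ha hP
  obtain ⟨Γ, β₀, ℓ₀, c, C, -, -, hpos, hlim, -, -⟩ := hP
  obtain ⟨ℓ₀', β₂, umin, U, δ, c', K, L₀, M, J, Cert, humin, hδ, hc, hℓ₀', hJ, hL₀pos, hL₀, hseed, hbound, hdich,
    hcert⟩ := h G hG r a ha hpos hlim
  exact concl_of_ratchet r hpos (topAmp r) humin hδ hc hℓ₀' L₀ hL₀pos hL₀ M J hJ Cert hseed hbound hdich hcert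

/-! ## §6 The self-normalised fallback quantity (a priori bounded by RP monotonicity) -/

/-- `v(β, L) = Cov_{β,L}(P_0, P_{(L/8)e₂}) / Cov_{β,L}(P_0, P_{(L/16)e₂})`: the ratio of the package's axis covariance at
the two largest separations the package pins.  Physically `≈ 2⁻⁸ Γ(2s)/Γ(s)` (femto), `→ 0` (massive); bounded by `1`
wherever the torus two-point function is non-increasing in the separation (reflection positivity), so the BOUND stub of
the ratchet is RP bookkeeping for this quantity, and its SEED is the package's two-sidedness `c Γ(2s) / (C Γ(s))`. -/
def ratioAmp (r : LatticeRep G) (β : ℝ) (L : ℕ) : ℝ :=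
  if hL : L = 0 then 0 else
    haveI : NeZero L := ⟨hL⟩
    let P : (Fin 4 → ZMod L) → GaugeConfig 4 L G → ℝ :=
      fun x U => (r.N : ℝ) - (r.ρ (plaquetteHolonomy U x 0 1)).trace.re
    let E : (GaugeConfig 4 L G → ℝ) → ℝ := fun F => wilsonExpectation (d := 4) (L := L) r.ρ β F
    let cov : ℕ → ℝ := fun n =>
      E (fun U => P 0 U * P (Pi.single (2 : Fin 4) ((n : ℕ) : ZMod L)) U) -
        E (P 0) * E (P (Pi.single (2 : Fin 4) ((n : ℕ) : ZMod L)))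
    cov (L / 8) / cov (L / 16)

end

end Summit.QuantumFields.YangMills.Cruxes.LatticeGapInUVUnitsC.AmplitudeRatchet
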